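import Literature.Analysis.Calculus.PeriodicMollifier
import Summits.AnomalousDissipation.AnomalousDissipation.Theses.MirrorVariety
import Mathlib.Order.Fin.Tuple
import Mathlib.Topology.MetricSpace.Thickening
import HarnessLib

/-!
# Stub `stub_divIdentityBox` (D1a) of the line `Sketch` (half-turn parity forcing)
# (crux stmt-AnomalousDissipation-15060, `MirrorVariety.TaylorGreenLogLoudStates`)

The NON-PERIODIC divergence identity for the degree integrand (Chang, *Methods in Nonlinear
Analysis* (2005), §3.1, Lemma 3.1.3 and Thm. 3.1.4, step III restricted to `C¹`): for a closed box
`K = [a, b] ⊆ ℝⁿ⁺¹`, a `C¹` map `f : ℝⁿ⁺¹ → ℝⁿ⁺¹`, a differentiable compactly supported field `G`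
with continuous divergence `ψ = ∑ᵢ ∂ᵢ Gᵢ`, and the boundary condition `f(∂K) ∩ tsupport G = ∅`,

  `∫_K ψ(f x) · det Df(x) dx = 0`.

This is the twin of the tree's periodic statement
`Literature.Analysis.Calculus.integral_divG_comp_mul_det_eq_zero` (`PeriodicMollifier.lean`), with
the boundary term of Mathlib's divergence theorem on the box
(`MeasureTheory.integral_divergence_of_hasFDerivAt_off_countable`) killed by the support condition
instead of periodicity:

* `integral_divG_comp_mul_det_eq_zero_of_contDiff_box` — the `C²` case: `ψ(f) det Df = div W` for
  the Piola field `W = adj(Df) · G∘f` (`sum_fderiv_piolaField`), and `W` vanishes at every boundary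
  point of the box (there `G (f x) = 0`), so every face flux is zero.
* `stub_divIdentityBox` — the registered `C¹` statement, by mollification
  (`exists_contDiff_approx_fderiv`): `f(∂K)` is compact and disjoint from the closed `tsupport G`,
  hence at positive distance `δ` (`Disjoint.exists_thickenings`); a smooth `g` that is `δ`-close to
  `f` on `K` still satisfies `G ∘ g = 0` on `∂K`, so the `C²` case applies to `g`, and
  `ψ(g) det Dg → ψ(f) det Df` uniformly on `K` by uniform continuity of `(v, A) ↦ ψ(v) det A` on a
  compact neighbourhood of `{(f x, Df x) : x ∈ K}` (the estimate is verbatim the periodic one).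

Degenerate boxes (`a i = b i` for some `i`) need no separate treatment: Mathlib's divergence
theorem only asks `a ≤ b`. No definitions, no named facts, no `sorry`.

## References

* K.-C. Chang, *Methods in Nonlinear Analysis* (2005), §3.1, Lemma 3.1.3, Thm. 3.1.4. [Chang2005]
-/

-- `Summit.<Summit>.<Problem>` is the tree's mandated summit-side namespace (CONVENTIONS §2); duplicate deliberate.
set_option linter.dupNamespace false

noncomputable section

open MeasureTheory Set Function Metric Filter
open scoped Topology BigOperators
open Literature.Analysis.Calculus

namespace Summit.AnomalousDissipation.AnomalousDissipation.Theorems.TaylorGreenLogLoudStates.HalfTurn.DivIdentity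

variable {n : ℕ}

/-! ## Boundary points of a box and the Piola field there -/

/-- The Piola field `W(x)ⱼ = ∑ᵢ Cᵢⱼ(x) Gᵢ(f x)` vanishes at every point where `G (f x) = 0`.
[folklore] -/
theorem piolaField_eq_zero_of_apply_eq_zero {f G : (Fin (n + 1) → ℝ) → Fin (n + 1) → ℝ}
    {x : Fin (n + 1) → ℝ} (hx : G (f x) = 0) : piolaField f G x = 0 := by
  funext j
  simp [piolaField, hx]

/-- A point of a face of the box `[a, b]` (its `i`-th coordinate equal to `a i` or `b i`, the
others in the face box) lies in `[a, b]` but not in the open box `∏ (a j, b j)`. [folklore] -/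
theorem insertNth_mem_Icc_notMem_pi {a b : Fin (n + 1) → ℝ} (hle : a ≤ b) (i : Fin (n + 1))
    {c : ℝ} (hc : c = a i ∨ c = b i) {y : Fin n → ℝ}
    (hy : y ∈ Icc (a ∘ Fin.succAbove i) (b ∘ Fin.succAbove i)) :
    (Fin.insertNth i c y : Fin (n + 1) → ℝ) ∈ Icc a b ∧
      (Fin.insertNth i c y : Fin (n + 1) → ℝ) ∉ Set.pi univ (fun j => Ioo (a j) (b j)) := by
  constructor
  · refine Fin.insertNth_mem_Icc.2 ⟨?_, hy⟩
    rcases hc with rfl | rfl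
    · exact ⟨le_rfl, hle i⟩
    · exact ⟨hle i, le_rfl⟩
  · intro hmem
    have hi := hmem i (mem_univ i)
    rw [Fin.insertNth_apply_same] at hi
    rcases hc with rfl | rfl
    · exact lt_irrefl _ hi.1
    · exact lt_irrefl _ hi.2

/-! ## The `C²` case: divergence theorem on the box for the Piola field -/

/-- **`∫_K (div G)(f) det Df = 0` for `C²` maps, boundary term killed by a support condition.**
Let `f : ℝⁿ⁺¹ → ℝⁿ⁺¹` be `C²`, `G` differentiable with continuous divergence `ψ = ∑ᵢ ∂ᵢ Gᵢ`,
and suppose `G (f x) = 0` at every point `x` of the box `[a, b]` outside the open box. Then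
`∫_{[a,b]} ψ(f x) · det Df(x) dx = 0`: `ψ(f) det Df = div W` for the Piola field
`W = adj(Df) · G∘f` (`sum_fderiv_piolaField`), and in Mathlib's divergence theorem on the box every
face integrand `W (Fin.insertNth i (b i) y) i`, `W (Fin.insertNth i (a i) y) i` vanishes, face
points being boundary points. (Chang 2005, Lemma 3.1.3 with Thm. 3.1.4.)
[cite: Chang2005, §3.1 Lemma 3.1.3 and Thm 3.1.4] -/
theorem integral_divG_comp_mul_det_eq_zero_of_contDiff_box {a b : Fin (n + 1) → ℝ} (hle : a ≤ b)
    {f : (Fin (n + 1) → ℝ) → Fin (n + 1) → ℝ} (hf : ContDiff ℝ 2 f)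
    {G : (Fin (n + 1) → ℝ) → Fin (n + 1) → ℝ} (hG : Differentiable ℝ G)
    {ψ : (Fin (n + 1) → ℝ) → ℝ} (hψ : Continuous ψ)
    (hGψ : ∀ v, ∑ i, fderiv ℝ G v (Pi.single i 1) i = ψ v)
    (hbd : ∀ x ∈ Icc a b, x ∉ Set.pi univ (fun i => Ioo (a i) (b i)) → G (f x) = 0) :
    ∫ x in Icc a b, ψ (f x) * (fderiv ℝ f x).det = 0 := by
  set W : (Fin (n + 1) → ℝ) → Fin (n + 1) → ℝ := piolaField f G with hW
  have hfx : ∀ x, ContDiffAt ℝ 2 f x := fun x => hf.contDiffAt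
  have hdW : ∀ x, HasFDerivAt W (fderiv ℝ W x) x := fun x =>
    (hasFDerivAt_piolaField (hfx x) (hG (f x))).differentiableAt.hasFDerivAt
  have hdiv : ∀ x, ∑ i, fderiv ℝ W x (Pi.single i 1) i = ψ (f x) * (fderiv ℝ f x).det := by
    intro x
    rw [hW, sum_fderiv_piolaField (hfx x) (hG (f x)), hGψ]
  -- continuity of the Piola field (adapted from `integral_divG_comp_mul_det_eq_zero_of_contDiff`)
  have hfd1 : Continuous (fderiv ℝ f) := hf.continuous_fderiv (by norm_num)
  have hcW : Continuous W := by
    refine continuous_pi fun j => continuous_finsetSum _ fun i _ => ?_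
    refine Continuous.mul ?_ ((continuous_apply i).comp (hG.continuous.comp hf.continuous))
    change Continuous fun x => detRowsCLM (Fin (n + 1)) (update (jacCols f x) j (Pi.single i 1))
    refine (detRowsCLM (Fin (n + 1))).cont.comp ?_
    refine continuous_pi fun k => ?_
    by_cases hkj : k = j
    · subst hkj
      simp only [update_self]
      exact continuous_const
    · simp only [update_of_ne hkj, jacCols]
      exact hfd1.clm_apply continuous_const
  -- integrability of the divergence
  have hint : IntegrableOn (fun x => ∑ i, fderiv ℝ W x (Pi.single i 1) i) (Icc a b) := by
    simp_rw [hdiv]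
    exact ((hψ.comp hf.continuous).mul
      (ContinuousLinearMap.continuous_det.comp hfd1)).integrableOn_Icc
  have h := integral_divergence_of_hasFDerivAt_off_countable a b hle W (fun x => fderiv ℝ W x) ∅
    countable_empty hcW.continuousOn (fun x _ => hdW x) hint
  simp_rw [hdiv] at h
  rw [h]
  refine Finset.sum_eq_zero fun i _ => ?_
  -- every face integrand vanishes: face points are boundary points, where `G ∘ f = 0`
  have hface : ∀ c : ℝ, (c = a i ∨ c = b i) →
      ∫ y in Icc (a ∘ Fin.succAbove i) (b ∘ Fin.succAbove i),
        W (Fin.insertNth i c y) i = 0 := by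
    intro c hc
    refine setIntegral_eq_zero_of_forall_eq_zero fun y hy => ?_
    obtain ⟨h1, h2⟩ := insertNth_mem_Icc_notMem_pi hle i hc hy
    rw [hW, piolaField_eq_zero_of_apply_eq_zero (hbd _ h1 h2)]
    rfl
  rw [hface (b i) (Or.inr rfl), hface (a i) (Or.inl rfl), sub_self]

/-! ## The registered stub: the `C¹` case by mollification -/

/-- **Stub `stub_divIdentityBox`** (D1a, = `DivIdentityBox`) — the non-periodic divergence
identity for the degree integrand: for a box `K = [a, b] ⊆ ℝⁿ⁺¹` (`a ≤ b`), a `C¹` map `f`, a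
differentiable compactly supported field `G` with continuous divergence `ψ = ∑ᵢ ∂ᵢ Gᵢ`, and
`f(∂K) ∩ tsupport G = ∅` (`∂K` = the points of `K` outside the open box), `∫_K ψ(f) det Df = 0`.
Proof: `f(∂K)` is compact and disjoint from the closed set `tsupport G`, hence `δ`-separated
(`Disjoint.exists_thickenings`); for the smooth mollifications `g` of `f`
(`exists_contDiff_approx_fderiv`) that are `δ`-close to `f` on `K` one still has `G ∘ g = 0` on
`∂K`, so the integral for `g` vanishes (`integral_divG_comp_mul_det_eq_zero_of_contDiff_box`), and
`ψ(g) det Dg → ψ(f) det Df` uniformly on `K` as `g → f` in `C¹(K)`, by uniform continuity of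
`(v, A) ↦ ψ(v) det A` on a compact neighbourhood of `{(f x, Df x) : x ∈ K}` (Chang 2005, §3.1,
Thm. 3.1.4 and step III). [cite: Chang2005, §3.1 Thm 3.1.4] -/
theorem stub_divIdentityBox :
    ∀ (n : ℕ) (a b : Fin (n + 1) → ℝ) (f G : (Fin (n + 1) → ℝ) → Fin (n + 1) → ℝ) (ψ : (Fin (n + 1) → ℝ) → ℝ),
    a ≤ b → ContDiff ℝ 1 f → Differentiable ℝ G → Continuous ψ →
    (∀ v, ∑ i, fderiv ℝ G v (Pi.single i 1) i = ψ v) → HasCompactSupport G →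
    (∀ x ∈ Set.Icc a b, x ∉ Set.pi Set.univ (fun i => Set.Ioo (a i) (b i)) → f x ∉ tsupport G) →
    ∫ x in Set.Icc a b, ψ (f x) * (fderiv ℝ f x).det = 0 := by
  intro n a b f G ψ hle hf hG hψ hGψ _hGc hbd
  have hKc : IsCompact (Icc a b) := isCompact_Icc
  have hfc1 : Continuous (fderiv ℝ f) := hf.continuous_fderiv one_ne_zero
  -- the boundary `B = K \ open box`, compact, with `f '' B` at positive distance from `tsupport G`
  set B : Set (Fin (n + 1) → ℝ) := Icc a b \ Set.pi univ (fun i => Ioo (a i) (b i)) with hB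
  have hBc : IsCompact B := hKc.diff (isOpen_set_pi finite_univ fun i _ => isOpen_Ioo)
  have hfBc : IsCompact (f '' B) := hBc.image hf.continuous
  have hdisj : Disjoint (f '' B) (tsupport G) := by
    rw [Set.disjoint_left]
    rintro _ ⟨x, ⟨hxK, hxn⟩, rfl⟩
    exact hbd x hxK hxn
  obtain ⟨δ, hδ, hδd⟩ := hdisj.exists_thickenings hfBc (isClosed_tsupport G)
  -- for `g` uniformly `δ`-close to `f` on `K`, `G ∘ g` vanishes on `B`
  have hvan : ∀ g : (Fin (n + 1) → ℝ) → Fin (n + 1) → ℝ, (∀ x ∈ Icc a b, ‖g x - f x‖ < δ) →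
      ∀ x ∈ Icc a b, x ∉ Set.pi univ (fun i => Ioo (a i) (b i)) → G (g x) = 0 := by
    intro g hg x hxK hxn
    apply image_eq_zero_of_notMem_tsupport
    intro hmem
    have h1 : g x ∈ thickening δ (f '' B) := by
      rw [mem_thickening_iff]
      exact ⟨f x, ⟨x, ⟨hxK, hxn⟩, rfl⟩, by rw [dist_eq_norm]; exact hg x hxK⟩
    have h2 : g x ∈ thickening δ (tsupport G) := self_subset_thickening hδ _ hmem
    exact Set.disjoint_left.1 hδd h1 h2
  -- the rest is the limit argument of `integral_divG_comp_mul_det_eq_zero` (PeriodicMollifier)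
  set K : Set (Fin (n + 1) → ℝ) := Icc a b with hK
  -- the integrand of `f` and its integrability
  have hIf : Continuous fun x => ψ (f x) * (fderiv ℝ f x).det :=
    (hψ.comp hf.continuous).mul (ContinuousLinearMap.continuous_det.comp hfc1)
  -- the continuous function `Φ (v, A) = ψ v * det A` and the compact set of values
  set Φ : (Fin (n + 1) → ℝ) × ((Fin (n + 1) → ℝ) →L[ℝ] Fin (n + 1) → ℝ) → ℝ :=
    fun p => ψ p.1 * p.2.det with hΦ
  have hΦc : Continuous Φ :=
    (hψ.comp continuous_fst).mul (ContinuousLinearMap.continuous_det.comp continuous_snd)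
  set C := (fun x => (f x, fderiv ℝ f x)) '' K with hC
  have hCc : IsCompact C := hKc.image (hf.continuous.prodMk hfc1)
  have hC₁ : IsCompact (cthickening 1 C) := hCc.cthickening
  -- main estimate: `‖∫_K ψ(f) det Df‖ ≤ η vol K` for every `η > 0`
  have hest : ∀ η : ℝ, 0 < η →
      ‖∫ x in K, ψ (f x) * (fderiv ℝ f x).det‖ ≤ η * volume.real K := by
    intro η hη
    obtain ⟨δ₁, hδ₁, hδ₁Φ⟩ := Metric.uniformContinuousOn_iff.mp
      (hC₁.uniformContinuousOn_of_continuous hΦc.continuousOn) η hη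
    obtain ⟨g, hg, -, hg0', hg1'⟩ := exists_contDiff_approx_fderiv hf hKc
      (lt_min (lt_min (half_pos hδ₁) one_half_pos) (half_pos hδ))
    have hg0 : ∀ x ∈ K, ‖g x - f x‖ ≤ min (δ₁ / 2) (1 / 2) := fun x hx =>
      (hg0' x hx).trans (min_le_left _ _)
    have hg1 : ∀ x ∈ K, ‖fderiv ℝ g x - fderiv ℝ f x‖ ≤ min (δ₁ / 2) (1 / 2) := fun x hx =>
      (hg1' x hx).trans (min_le_left _ _)
    have hgδ : ∀ x ∈ K, ‖g x - f x‖ < δ := fun x hx =>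
      lt_of_le_of_lt ((hg0' x hx).trans (min_le_right _ _)) (half_lt_self hδ)
    have hg2 : ContDiff ℝ 2 g := contDiff_infty.1 hg 2
    have hIg0 : ∫ x in K, ψ (g x) * (fderiv ℝ g x).det = 0 :=
      integral_divG_comp_mul_det_eq_zero_of_contDiff_box hle hg2 hG hψ hGψ (hvan g hgδ)
    have hgc1 : Continuous (fderiv ℝ g) := hg.continuous_fderiv (by simp)
    have hIg : Continuous fun x => ψ (g x) * (fderiv ℝ g x).det :=
      (hψ.comp hg.continuous).mul (ContinuousLinearMap.continuous_det.comp hgc1)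
    -- pointwise closeness of the integrands on `K`
    have hclose : ∀ x ∈ K,
        ‖ψ (f x) * (fderiv ℝ f x).det - ψ (g x) * (fderiv ℝ g x).det‖ ≤ η := by
      intro x hx
      have hp : (f x, fderiv ℝ f x) ∈ C := ⟨x, hx, rfl⟩
      have hq : (g x, fderiv ℝ g x) ∈ cthickening 1 C :=
        Metric.mem_cthickening_of_dist_le _ _ 1 C hp (by
          have h1 : min (δ₁ / 2) (1 / 2 : ℝ) ≤ 1 / 2 := min_le_right _ _
          rw [Prod.dist_eq, dist_eq_norm, dist_eq_norm]
          have := max_le (hg0 x hx) (hg1 x hx)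
          linarith)
      have hlt : dist (g x, fderiv ℝ g x) (f x, fderiv ℝ f x) < δ₁ := by
        have h1 : min (δ₁ / 2) (1 / 2 : ℝ) ≤ δ₁ / 2 := min_le_left _ _
        rw [Prod.dist_eq, dist_eq_norm, dist_eq_norm]
        have := max_le (hg0 x hx) (hg1 x hx)
        linarith
      have := hδ₁Φ _ hq _ (self_subset_cthickening C hp) hlt
      rw [dist_eq_norm] at this
      simpa [Φ, norm_sub_rev] using this.le
    have hKfin : volume K < ⊤ := hKc.measure_lt_top
    calc ‖∫ x in K, ψ (f x) * (fderiv ℝ f x).det‖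
        = ‖(∫ x in K, ψ (f x) * (fderiv ℝ f x).det) - ∫ x in K, ψ (g x) * (fderiv ℝ g x).det‖ := by
          rw [hIg0, sub_zero]
      _ = ‖∫ x in K, (ψ (f x) * (fderiv ℝ f x).det - ψ (g x) * (fderiv ℝ g x).det)‖ := by
          rw [← integral_sub (hIf.continuousOn.integrableOn_compact hKc)
            (hIg.continuousOn.integrableOn_compact hKc)]
      _ ≤ η * volume.real K := norm_setIntegral_le_of_norm_le_const hKfin hclose
  -- conclusion
  have hfin : ‖∫ x in K, ψ (f x) * (fderiv ℝ f x).det‖ ≤ 0 := by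
    rcases (measureReal_nonneg : 0 ≤ volume.real K).eq_or_lt with h0 | hpos
    · simpa [← h0] using hest 1 one_pos
    · refine le_of_forall_pos_le_add fun ε hε => ?_
      have := hest (ε / volume.real K) (div_pos hε hpos)
      rw [div_mul_cancel₀ _ hpos.ne'] at this
      linarith
  exact norm_le_zero_iff.mp hfin

end Summit.AnomalousDissipation.AnomalousDissipation.Theorems.TaylorGreenLogLoudStates.HalfTurn.DivIdentity

end
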